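import Literature.MathematicalPhysics.QuantumFieldTheory.IsingGaugePlaquetteCovarianceDuality
import Literature.Probability.LatticeModels.IsingHighTemperatureEvenClustering
import HarnessLib

/-!
# Exponential clustering of Wilson loops of `ℤ₂` lattice gauge theory on `ℤ³` in the deconfined phase
(the large-`β` half of Forsström–Viklund 2025, Prop. 6.8 ∕ Duncan–Schweinhart 2026, Prop. 24, `d = 3`,
`q = 2`, for GENERAL rectangular loops — as a THEOREM, by duality)

Topic `MathematicalPhysics/QuantumFieldTheory`. Theorem-only file (no definitions, no named facts).

For two rectangular Wilson loops `γ = ∂𝒮`, `γ' = ∂𝒮'` of `ℤ₂` lattice gauge theory on `ℤ³` (free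
infinite-volume state, the tree's box limit), with flat sheets `𝒮 = rectPlaqs x i j R T`,
`𝒮' = rectPlaqs x' i' j' R' T'` in coordinate planes (`i < j`, `i' < j'`), and every
`β > β_c = z2GaugeCriticalBetaThree` (the deconfined phase):
`0 ≤ ⟨W_γ ; W_{γ'+a}⟩_β ≤ c(β, γ, γ') e^{-2κ(β*)‖a‖}` for all lattice vectors `a`
(`znWilsonPairCov_deconfined_clustering`), where `κ(β*) > 0` is the sharpness rate of the dual Ising
two-point function at the dual temperature `β* = -½ log tanh β < β_c^{Ising}(ℤ³)`.

The proof is Kramers–Wannier–Wegner duality of TRUNCATED correlations for general sheets: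

* §1 flat sheets: membership, orientation, the dual bonds `{y - e_k, y}` of the faces `(y; i, j)`
  (`k` the third direction) are pairwise disjoint, containment in the gauge boxes, distances;
* §2 `T_{𝒮*} = ∏_{b ∈ 𝒮*} e^{-2β* σ_b} = ∑_{U ⊆ 𝒮} (-sinh 2β*)^{|U|} (cosh 2β*)^{|𝒮∖U|} σ_{verts U}`
  (`disorderWeight_rectPlaqs_eq_sum`, generalising the tree's `disorderWeight_sheet_eq_sum` from the
  base point `e₃` to arbitrary flat sheets);
* §3 Aizenman 2025 Thm 9.2 (2) (the tree's `zdExpect_z2_prod_plaqSpin_eq_isingExpect_plus_disorderWeight`)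
  for `𝒮`, `𝒮'` and `𝒮 ∪ 𝒮'` gives the finite-volume identity
  `Cov^{free}_{ΛG_M,β}(W_γ, W_{γ'}) = ∑_{U ⊆ 𝒮, U' ⊆ 𝒮'} c_U c'_{U'} Cov⁺_{box M,β*}(σ_{verts U}, σ_{verts U'})`
  (`zdCov_wilsonLoop_eq_sum`), and §4 its infinite-volume form (`znWilsonPairCov_eq_sum_plusCov`,
  all `β > 0`, disjoint sheets);
* §5 for `β > β_c` the dual plus state is the free state (Lebowitz–Martin-Löf), and each
  `Cov^∅_{β*}(σ_A, σ_B)` with `A = verts U`, `B = verts U'` EVEN sets at distance `≥ ‖a‖ - K` is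
  `≤ C e^{-2κ(‖a‖-K)}` by the lattice Glimm–Jaffe §17.2 bound
  (`freeCorr_evenCov_expDecay_of_lt_criticalBeta` of `IsingHighTemperatureEvenClustering`: pair
  truncation + Newman's Gaussian inequality + sharpness); nearby translates are absorbed by
  `0 ≤ Cov ≤ 1`.

This is the `d = 3`, `ℤ₂`, large-`β` half of Forsström–Viklund's Prop. 6.8 (covariance of loop
observables decays exponentially in the distance, constants depending on the loops; their proof cites
[GH2010]) and the fixed-loop, dual-subcritical case of Duncan–Schweinhart's Prop. 24 — here a theorem
of the tree with `0` named facts. The small-`β` half (every `ℤ_n`, every `d ≥ 2`) is the tree's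
`znWilsonPairCov_strongCoupling_clustering`; the two unit plaquettes are
`z2PlaquettePairCov_le_exp_neg_of_gt_critical`.

HONEST FRAMING: `ℤ₂`, `d = 3` (cell `ym-ir`, census row A5 ∕ A9); abelian duality has width `0`
toward `SU(N)`; nothing here bears on four-dimensional Yang–Mills or the mass gap (Clay); in the `ym`
ladder only the conditional finite-`𝕋⁴` rung `BalabanLadder.UV` is closed by any route.

## References

* M. P. Forsström, F. Viklund, *Current expansion and couplings for Ising lattice gauge theory*, arXiv:2502.19942 (2025), Prop. 6.8. [ForsstromViklund2025currents]
* P. Duncan, B. Schweinhart, arXiv:2607.02434 (2026), Prop. 24 (pp. 19–20). [DuncanSchweinhart2026]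
* M. Aizenman, Math. Phys. Anal. Geom. 28 (2025), §9.2 Thm 9.2 (2), §9.3. [Aizenman2025]
* J. Glimm, A. Jaffe, *Quantum Physics*, 2nd ed. (1987), §17.2 Thm. 17.2.1, Cor. 17.2.2. [GlimmJaffe1987]
* J. L. Lebowitz, A. Martin-Löf, CMP 25 (1972) 276–282. [LebowitzMartinlof1972]
-/

noncomputable section

open MeasureTheory Finset Filter Topology
open scoped symmDiff
open Literature.Probability.LatticeModels
open Literature.Barriers.QuantumFields (rootsOfUnityCircle znRep)

namespace Literature.MathematicalPhysics.QuantumFieldTheory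

open AreaLaw

namespace Z2Duality

/-! ### §1 Flat sheets: faces, dual bonds, gauge boxes, distances -/

section Sheets

variable {x : Probability.LatticeModels.Site 3} {i j : Fin 3} {R T : ℕ}

/-- Membership in the flat sheet: the faces `(x + t eⱼ + s eᵢ; i, j)`, `t < T`, `s < R`. [folklore] -/
private theorem mem_rectPlaqs_iff {f : Plaq 3} :
    f ∈ rectPlaqs x i j R T ↔
      ∃ t s : ℕ, t < T ∧ s < R ∧ f = (x + Pi.single j (t : ℤ) + Pi.single i (s : ℤ), i, j) := by
  unfold rectPlaqs
  simp only [Finset.mem_image, Finset.mem_product, Finset.mem_range, Prod.exists]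
  constructor
  · rintro ⟨t, s, ⟨ht, hs⟩, rfl⟩; exact ⟨t, s, ht, hs, rfl⟩
  · rintro ⟨t, s, ht, hs, rfl⟩; exact ⟨t, s, ⟨ht, hs⟩, rfl⟩

/-- Sheet faces have directions `(i, j)`. [folklore] -/
private theorem sheetFace_snd {f : Plaq 3} (hf : f ∈ rectPlaqs x i j R T) : f.2 = (i, j) := by
  obtain ⟨t, s, -, -, rfl⟩ := mem_rectPlaqs_iff.1 hf
  rfl

/-- Sheet faces are positively oriented when `i < j`. [folklore] -/
private theorem sheetFace_oriented (hij : i < j) {f : Plaq 3} (hf : f ∈ rectPlaqs x i j R T) :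
    f ∈ {f : Plaq 3 | f.2.1 < f.2.2} := by
  obtain ⟨t, s, -, -, rfl⟩ := mem_rectPlaqs_iff.1 hf
  exact hij

/-- The lower cube of a face differs from its upper cube. [folklore] -/
private theorem lowCube_ne_fst (f : Plaq 3) : lowCube f ≠ f.1 := by
  intro h
  have h' := lowCube_add f
  rw [h, add_eq_left] at h'
  have := congrFun h' (third f.2.1 f.2.2)
  simp at this

/-- The third coordinate of the upper cube of a sheet face is that of the base point. [folklore] -/
private theorem sheetFace_fst_apply_third (hij : i ≠ j) {f : Plaq 3} (hf : f ∈ rectPlaqs x i j R T) :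
    f.1 (third i j) = x (third i j) := by
  obtain ⟨t, s, -, -, rfl⟩ := mem_rectPlaqs_iff.1 hf
  simp [third_ne_left hij, third_ne_right hij]

/-- The third coordinate of the lower cube of a sheet face is one less. [folklore] -/
private theorem lowCube_apply_third (hij : i ≠ j) {f : Plaq 3} (hf : f ∈ rectPlaqs x i j R T) :
    lowCube f (third i j) = x (third i j) - 1 := by
  obtain ⟨t, s, -, -, rfl⟩ := mem_rectPlaqs_iff.1 hf
  simp [lowCube, third_ne_left hij, third_ne_right hij]

/-- A sheet face is determined by its upper cube. [folklore] -/
private theorem sheetFace_eq_of_fst_eq {f g : Plaq 3} (hf : f ∈ rectPlaqs x i j R T)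
    (hg : g ∈ rectPlaqs x i j R T) (h : f.1 = g.1) : f = g :=
  Prod.ext h (by rw [sheetFace_snd hf, sheetFace_snd hg])

/-- A sheet face is determined by its lower cube. [folklore] -/
private theorem sheetFace_eq_of_lowCube_eq {f g : Plaq 3} (hf : f ∈ rectPlaqs x i j R T)
    (hg : g ∈ rectPlaqs x i j R T) (h : lowCube f = lowCube g) : f = g := by
  refine sheetFace_eq_of_fst_eq hf hg ?_
  have h2 : f.2 = g.2 := by rw [sheetFace_snd hf, sheetFace_snd hg]
  rw [← lowCube_add f, ← lowCube_add g, h, show f.2.1 = g.2.1 from congrArg Prod.fst h2,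
    show f.2.2 = g.2.2 from congrArg Prod.snd h2]

/-- **Distinct faces of a flat sheet have disjoint dual bonds** (`i ≠ j`): the upper cubes lie at
third coordinate `x_k`, the lower cubes at `x_k - 1`. [cite: Aizenman2025, §9.3 (the dual bonds crossing S)] -/
theorem rectPlaqs_pairwiseDisjoint_dualVerts (x : Probability.LatticeModels.Site 3) (hij : i ≠ j) (R T : ℕ) :
    (↑(rectPlaqs x i j R T) : Set (Plaq 3)).PairwiseDisjoint
      fun f => ({lowCube f, f.1} : Finset (Probability.LatticeModels.Site 3)) := by
  intro f hf g hg hne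
  have hf' : f ∈ rectPlaqs x i j R T := hf
  have hg' : g ∈ rectPlaqs x i j R T := hg
  rw [Function.onFun, Finset.disjoint_left]
  intro v hvf hvg
  simp only [Finset.mem_insert, Finset.mem_singleton] at hvf hvg
  have hk1 := sheetFace_fst_apply_third hij hf'
  have hk2 := sheetFace_fst_apply_third hij hg'
  have hk3 := lowCube_apply_third hij hf'
  have hk4 := lowCube_apply_third hij hg'
  rcases hvf with rfl | rfl <;> rcases hvg with h | h
  · exact hne (sheetFace_eq_of_lowCube_eq hf' hg' h)
  · have := congrFun h (third i j); rw [hk3, hk2] at this; omega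
  · have := congrFun h (third i j); rw [hk1, hk4] at this; omega
  · exact hne (sheetFace_eq_of_fst_eq hf' hg' h)

/-- `dualEdge` is injective on a flat sheet together with any other set of oriented faces. [cite: Aizenman2025, §9.2] -/
private theorem dualEdge_inj_of_oriented {f g : Plaq 3} (hf : f ∈ {f : Plaq 3 | f.2.1 < f.2.2})
    (hg : g ∈ {f : Plaq 3 | f.2.1 < f.2.2}) (h : dualEdge f = dualEdge g) : f = g :=
  dualEdge_injOn hf hg h

/-- **Flat sheets lie in the gauge boxes `ΛG_M` for all large `M`.** [cite: Aizenman2025, §9.3 («for any domain Λ ⊂ ℤ³ which is large enough to contain it»)] -/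
theorem exists_rectPlaqs_subset_faces (x : Probability.LatticeModels.Site 3) (hij : i < j) (R T : ℕ) :
    ∃ M₀ : ℕ, ∀ M : ℕ, M₀ ≤ M → rectPlaqs x i j R T ⊆ plaquettesIn (gaugeBox M) := by
  refine ⟨(|x 0| + |x 1| + |x 2|).toNat + R + T + 1, fun M hM f hf => ?_⟩
  obtain ⟨t, s, ht, hs, rfl⟩ := mem_rectPlaqs_iff.1 hf
  rw [mem_faces_iff]
  refine ⟨hij, fun k => ?_⟩
  have hA : 0 ≤ |x 0| + |x 1| + |x 2| := by positivity
  have hM' : ((|x 0| + |x 1| + |x 2|).toNat : ℤ) + R + T + 1 ≤ M := by exact_mod_cast hM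
  rw [Int.toNat_of_nonneg hA] at hM'
  have h0 := le_abs_self (x 0); have h0' := neg_abs_le (x 0)
  have h1 := le_abs_self (x 1); have h1' := neg_abs_le (x 1)
  have h2 := le_abs_self (x 2); have h2' := neg_abs_le (x 2)
  have ht' : (t : ℤ) < T := by exact_mod_cast ht
  have hs' : (s : ℤ) < R := by exact_mod_cast hs
  simp only [Pi.add_apply, Pi.single_apply]
  fin_cases k <;> fin_cases i <;> fin_cases j <;> simp <;> omega

/-- The endpoints of the dual bonds of a face belong to `verts`. [folklore] -/
private theorem fst_mem_verts {U : Finset (Plaq 3)} {f : Plaq 3} (hf : f ∈ U) : f.1 ∈ verts U := by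
  unfold verts
  exact Finset.mem_biUnion.2 ⟨f, hf, by simp⟩

/-- `verts` is monotone. [folklore] -/
private theorem verts_mono {U S : Finset (Plaq 3)} (h : U ⊆ S) : verts U ⊆ verts S :=
  Finset.biUnion_subset_biUnion_of_subset_left _ h

/-- `|verts U| ≤ 2|U|`. [folklore] -/
private theorem card_verts_le (U : Finset (Plaq 3)) : (verts U).card ≤ 2 * U.card := by
  unfold verts
  calc _ ≤ ∑ f ∈ U, ({lowCube f, f.1} : Finset (Probability.LatticeModels.Site 3)).card :=
        Finset.card_biUnion_le
    _ ≤ ∑ f ∈ U, 2 := Finset.sum_le_sum fun f _ => Finset.card_le_two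
    _ = 2 * U.card := by rw [Finset.sum_const, smul_eq_mul, mul_comm]

/-- **The dual vertex set of part of a flat sheet is even**: `|verts U| = 2|U|` for `U ⊆ 𝒮`
(disjoint dual bonds). [cite: Aizenman2025, §9.3] -/
theorem even_card_verts_of_subset_rectPlaqs (hij : i ≠ j) {U : Finset (Plaq 3)}
    (hU : U ⊆ rectPlaqs x i j R T) : Even (verts U).card := by
  unfold verts
  rw [Finset.card_biUnion ((rectPlaqs_pairwiseDisjoint_dualVerts x hij R T).subset
    (Finset.coe_subset.2 hU))]
  rw [Finset.sum_congr rfl fun f _ => Finset.card_pair (lowCube_ne_fst f), Finset.sum_const,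
    smul_eq_mul]
  exact Nat.even_mul.2 (Or.inr even_two)

/-- `‖eₖ‖ = 1` and `‖c eₖ‖ = |c|` in the sup norm of `ℤ³`. [folklore] -/
private theorem norm_single_intCast (k : Fin 3) (c : ℤ) :
    ‖(Pi.single k c : Probability.LatticeModels.Site 3)‖ = |(c : ℝ)| := by
  rw [Pi.norm_single, Int.norm_eq_abs]

/-- **Dual vertices of a flat sheet are within `R + T + 1` of its base point** (sup norm). [folklore] -/
private theorem norm_sub_le_of_mem_verts {v : Probability.LatticeModels.Site 3}
    (hv : v ∈ verts (rectPlaqs x i j R T)) : ‖v - x‖ ≤ R + T + 1 := by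
  unfold verts at hv
  obtain ⟨f, hf, hvf⟩ := Finset.mem_biUnion.1 hv
  obtain ⟨t, s, ht, hs, rfl⟩ := mem_rectPlaqs_iff.1 hf
  have ht' : |((t : ℤ) : ℝ)| ≤ T := by
    rw [abs_of_nonneg (by positivity)]; exact_mod_cast ht.le
  have hs' : |((s : ℤ) : ℝ)| ≤ R := by
    rw [abs_of_nonneg (by positivity)]; exact_mod_cast hs.le
  have hn1 : ‖(Pi.single j (t : ℤ) : Probability.LatticeModels.Site 3)‖ ≤ T := by
    rw [norm_single_intCast]; exact ht'
  have hn2 : ‖(Pi.single i (s : ℤ) : Probability.LatticeModels.Site 3)‖ ≤ R := by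
    rw [norm_single_intCast]; exact hs'
  have hn3 : ‖(Pi.single (third i j) (1 : ℤ) : Probability.LatticeModels.Site 3)‖ ≤ 1 := by
    rw [norm_single_intCast]; simp
  have h12 : ‖(Pi.single j (t : ℤ) : Probability.LatticeModels.Site 3) + Pi.single i (s : ℤ)‖ ≤ R + T := by
    have := norm_add_le (Pi.single j (t : ℤ) : Probability.LatticeModels.Site 3) (Pi.single i (s : ℤ))
    linarith only [this, hn1, hn2]
  have h123 : ‖(Pi.single j (t : ℤ) : Probability.LatticeModels.Site 3) + Pi.single i (s : ℤ) -
      Pi.single (third i j) 1‖ ≤ R + T + 1 := by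
    have := norm_sub_le ((Pi.single j (t : ℤ) : Probability.LatticeModels.Site 3) + Pi.single i (s : ℤ))
      (Pi.single (third i j) 1)
    linarith only [this, h12, hn3]
  simp only [Finset.mem_insert, Finset.mem_singleton] at hvf
  rcases hvf with rfl | rfl
  · -- the lower cube `x + t eⱼ + s eᵢ - e_k`
    have heq : lowCube ((x + Pi.single j (t : ℤ) + Pi.single i (s : ℤ), i, j) : Plaq 3) - x =
        Pi.single j (t : ℤ) + Pi.single i (s : ℤ) - Pi.single (third i j) 1 := by
      simp only [lowCube]; abel
    rw [heq]; exact h123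
  · -- the upper cube `x + t eⱼ + s eᵢ`
    have heq : x + Pi.single j (t : ℤ) + Pi.single i (s : ℤ) - x =
        Pi.single j (t : ℤ) + Pi.single i (s : ℤ) := by abel
    rw [heq]; exact h12.trans (by linarith only)

/-- **Dual vertices of two sheets, one translated by `a`, are at sup-distance at least
`‖a‖ - (‖x - x'‖ + (R+T+1) + (R'+T'+1))`.** [folklore] -/
private theorem norm_sub_ge_of_mem_verts {x x' a : Probability.LatticeModels.Site 3} {i j i' j' : Fin 3}
    {R T R' T' : ℕ} {v v' : Probability.LatticeModels.Site 3}
    (hv : v ∈ verts (rectPlaqs x i j R T)) (hv' : v' ∈ verts (rectPlaqs (x' + a) i' j' R' T')) :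
    ‖a‖ - (‖x - x'‖ + (R + T + 1) + (R' + T' + 1)) ≤ ‖v - v'‖ := by
  have h1 := norm_sub_le_of_mem_verts hv
  have h2 := norm_sub_le_of_mem_verts hv'
  have key : a = (v - x) + (x - x') - (v' - (x' + a)) - (v - v') := by abel
  have ha : ‖a‖ ≤ ‖v - x‖ + ‖x - x'‖ + ‖v' - (x' + a)‖ + ‖v - v'‖ := by
    calc ‖a‖ = ‖(v - x) + (x - x') - (v' - (x' + a)) - (v - v')‖ := by rw [← key]
      _ ≤ ‖(v - x) + (x - x') - (v' - (x' + a))‖ + ‖v - v'‖ := norm_sub_le _ _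
      _ ≤ ‖(v - x) + (x - x')‖ + ‖v' - (x' + a)‖ + ‖v - v'‖ := by
          have := norm_sub_le ((v - x) + (x - x')) (v' - (x' + a)); linarith
      _ ≤ ‖v - x‖ + ‖x - x'‖ + ‖v' - (x' + a)‖ + ‖v - v'‖ := by
          have := norm_add_le (v - x) (x - x'); linarith
  linarith

/-- **Far-apart sheets are disjoint, and so are their dual vertex sets.** [folklore] -/
private theorem disjoint_of_far {x x' a : Probability.LatticeModels.Site 3} {i j i' j' : Fin 3}
    {R T R' T' : ℕ} (ha : ‖x - x'‖ + (R + T + 1) + (R' + T' + 1) < ‖a‖) :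
    Disjoint (rectPlaqs x i j R T) (rectPlaqs (x' + a) i' j' R' T') ∧
      ∀ {U U' : Finset (Plaq 3)}, U ⊆ rectPlaqs x i j R T → U' ⊆ rectPlaqs (x' + a) i' j' R' T' →
        Disjoint (verts U) (verts U') := by
  have hvv : ∀ {v v' : Probability.LatticeModels.Site 3}, v ∈ verts (rectPlaqs x i j R T) →
      v' ∈ verts (rectPlaqs (x' + a) i' j' R' T') → v ≠ v' := by
    intro v v' hv hv' h
    have := norm_sub_ge_of_mem_verts hv hv'
    rw [h, sub_self, norm_zero] at this
    linarith
  refine ⟨Finset.disjoint_left.2 fun f hf hf' => hvv (fst_mem_verts hf) (fst_mem_verts hf') rfl,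
    fun hU hU' => Finset.disjoint_left.2 fun v hv hv' =>
      hvv (verts_mono hU hv) (verts_mono hU' hv') rfl⟩

end Sheets

/-! ### §2 The disorder operator of a flat sheet as a combination of spin products -/

section Expansion

variable {x : Probability.LatticeModels.Site 3} {i j : Fin 3} {R T : ℕ}

/-- `e^{-2βb} = -sinh(2β) b + cosh(2β)` for `b = ±1`. [folklore] -/
private theorem exp_neg_two_mul_eq'' {b : ℝ} (hb : b = 1 ∨ b = -1) (β : ℝ) :
    Real.exp (-2 * β * b) = -Real.sinh (2 * β) * b + Real.cosh (2 * β) := by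
  rcases hb with rfl | rfl
  · rw [mul_one, show -2 * β = -(2 * β) by ring, ← Real.cosh_sub_sinh]; ring
  · rw [show -2 * β * -1 = 2 * β by ring, ← Real.cosh_add_sinh]; ring

/-- **`T_{𝒮*}` of a flat sheet is a finite combination of spin products**:
`∏_{b ∈ 𝒮*} e^{-2βσ_b} = ∑_{U ⊆ 𝒮} (-sinh 2β)^{|U|} (cosh 2β)^{|𝒮∖U|} σ_{verts U}`
(`𝒮 = rectPlaqs x i j R T`, `i < j`; the tree's `disorderWeight_sheet_eq_sum` is the case
`x = e₃`, `(i,j) = (0,1)`). [cite: Aizenman2025, §9.3 (T_S as a spin observable)] -/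
theorem disorderWeight_rectPlaqs_eq_sum (β : ℝ) (x : Probability.LatticeModels.Site 3) (hij : i < j)
    (R T : ℕ) (σ : SpinConfig (Probability.LatticeModels.Site 3)) :
    disorderWeight β ((rectPlaqs x i j R T).image dualEdge) σ =
      ∑ U ∈ (rectPlaqs x i j R T).powerset,
        ((-Real.sinh (2 * β)) ^ U.card * Real.cosh (2 * β) ^ (rectPlaqs x i j R T \ U).card) *
          spinProduct (verts U) σ := by
  have hinj : ∀ f ∈ rectPlaqs x i j R T, ∀ g ∈ rectPlaqs x i j R T, dualEdge f = dualEdge g → f = g :=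
    fun f hf g hg h => dualEdge_inj_of_oriented (sheetFace_oriented hij hf) (sheetFace_oriented hij hg) h
  rw [disorderWeight, Finset.prod_image hinj]
  have hterm : ∀ f ∈ rectPlaqs x i j R T, Real.exp (-2 * β * bondSpin σ (dualEdge f)) =
      -Real.sinh (2 * β) * spinProduct {lowCube f, f.1} σ + Real.cosh (2 * β) := by
    intro f _
    rw [exp_neg_two_mul_eq'' (bondSpin_eq_one_or σ _) β, dualEdge,
      bondSpin_mk_eq_spinProduct (lowCube_ne_fst f)]
  rw [Finset.prod_congr rfl hterm, Finset.prod_add]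
  refine Finset.sum_congr rfl fun U hU => ?_
  have hUS : U ⊆ rectPlaqs x i j R T := Finset.mem_powerset.1 hU
  have hsp : spinProduct (verts U) σ = ∏ f ∈ U, spinProduct {lowCube f, f.1} σ := by
    unfold verts spinProduct
    exact Finset.prod_biUnion
      ((rectPlaqs_pairwiseDisjoint_dualVerts x hij.ne R T).subset (Finset.coe_subset.2 hUS))
  rw [hsp, Finset.prod_mul_distrib, Finset.prod_const, Finset.prod_const]
  ring

/-- Linearity: the expectation of a finite combination of spin products. [folklore] -/
private theorem isingExpect_sum_mul_spinProduct {ι : Type*} (s : Finset ι) (c : ι → ℝ)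
    (B : ι → Finset (Probability.LatticeModels.Site 3)) (Λ : Finset (Probability.LatticeModels.Site 3))
    (β : ℝ) (bc : BoundaryCondition (Probability.LatticeModels.Site 3)) :
    isingExpect (zdGraph 3) Λ β 0 bc (fun σ => ∑ k ∈ s, c k * spinProduct (B k) σ) =
      ∑ k ∈ s, c k * isingCorr (zdGraph 3) Λ β 0 bc (B k) := by
  unfold isingExpect isingCorr isingExpect
  rw [integral_finsetSum _ fun k _ => (integrable_spinProduct _ (B k)).const_mul (c k)]
  exact Finset.sum_congr rfl fun k _ => integral_const_mul _ _

/-- The absolute value of a coefficient of the expansion is at most `cosh(2β)^{|𝒮|}` (`β ≥ 0`). [folklore] -/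
private theorem abs_coef_le {b : ℝ} (hb : 0 ≤ b) {S U : Finset (Plaq 3)} (hU : U ⊆ S) :
    |(-Real.sinh (2 * b)) ^ U.card * Real.cosh (2 * b) ^ (S \ U).card| ≤ Real.cosh (2 * b) ^ S.card := by
  have hsh : 0 ≤ Real.sinh (2 * b) := Real.sinh_nonneg_iff.2 (by linarith)
  have hch : 0 ≤ Real.cosh (2 * b) := (Real.cosh_pos _).le
  have hle : Real.sinh (2 * b) ≤ Real.cosh (2 * b) := (Real.sinh_lt_cosh _).le
  rw [abs_mul, abs_pow, abs_neg, abs_of_nonneg hsh, abs_of_nonneg (pow_nonneg hch _)]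
  calc _ ≤ Real.cosh (2 * b) ^ U.card * Real.cosh (2 * b) ^ (S \ U).card :=
        mul_le_mul_of_nonneg_right (pow_le_pow_left₀ hsh hle _) (pow_nonneg hch _)
    _ = Real.cosh (2 * b) ^ S.card := by
        rw [← pow_add, Finset.card_sdiff_of_subset hU, Nat.add_sub_cancel' (Finset.card_le_card hU)]

end Expansion

/-! ### §3 Duality of the truncated two-loop function, finite volume -/

section FiniteVolume

variable {M : ℕ}

/-- **One loop**: `⟨W_γ⟩^{free}_{ΛG_M,β} = ∑_{U ⊆ 𝒮} c_U ⟨σ_{verts U}⟩⁺_{box M,β*}`,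
`c_U = (-sinh 2β*)^{|U|}(cosh 2β*)^{|𝒮∖U|}` (Thm 9.2 (2) and the expansion of `T_{𝒮*}`).
[cite: Aizenman2025, §9.2 Thm 9.2 (2), §9.3] -/
theorem zdExpect_wilsonLoop_eq_sum {β : ℝ} (hβ : 0 < β) {x : Probability.LatticeModels.Site 3}
    {i j : Fin 3} (hij : i < j) {R T : ℕ} (hS : rectPlaqs x i j R T ⊆ plaquettesIn (gaugeBox M)) :
    zdExpect (znRep 2) β (gaugeBox M) (zdWilsonLoop (znRep 2) x i j R T) =
      ∑ U ∈ (rectPlaqs x i j R T).powerset,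
        ((-Real.sinh (2 * dualBeta β)) ^ U.card * Real.cosh (2 * dualBeta β) ^ (rectPlaqs x i j R T \ U).card) *
          isingCorr (zdGraph 3) (box 3 M) (dualBeta β) 0 .plus (verts U) := by
  rw [zdExpect_z2_wilsonLoop_eq_isingExpect_plus_disorderWeight hβ hij hS,
    show disorderWeight (dualBeta β) ((rectPlaqs x i j R T).image dualEdge) = fun σ =>
      ∑ U ∈ (rectPlaqs x i j R T).powerset,
        ((-Real.sinh (2 * dualBeta β)) ^ U.card * Real.cosh (2 * dualBeta β) ^ (rectPlaqs x i j R T \ U).card) *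
          spinProduct (verts U) σ from funext (disorderWeight_rectPlaqs_eq_sum (dualBeta β) x hij R T),
    isingExpect_sum_mul_spinProduct]

/-- **Two loops with disjoint sheets**: `⟨W_γ W_{γ'}⟩^{free}_{ΛG_M,β} =
∑_{U ⊆ 𝒮, U' ⊆ 𝒮'} c_U c'_{U'} ⟨σ_{verts U ∆ verts U'}⟩⁺_{box M,β*}` (Thm 9.2 (2) for `𝒮 ∪ 𝒮'`,
`T_{(𝒮∪𝒮')*} = T_{𝒮*} T_{𝒮'*}`). [cite: Aizenman2025, §9.2 Thm 9.2 (2), §9.3] -/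
theorem zdExpect_wilsonLoop_mul_eq_sum {β : ℝ} (hβ : 0 < β) {x x' : Probability.LatticeModels.Site 3}
    {i j i' j' : Fin 3} (hij : i < j) (hij' : i' < j') {R T R' T' : ℕ}
    (hS : rectPlaqs x i j R T ⊆ plaquettesIn (gaugeBox M))
    (hS' : rectPlaqs x' i' j' R' T' ⊆ plaquettesIn (gaugeBox M))
    (hdisj : Disjoint (rectPlaqs x i j R T) (rectPlaqs x' i' j' R' T')) :
    zdExpect (znRep 2) β (gaugeBox M) (fun U =>
        zdWilsonLoop (znRep 2) x i j R T U * zdWilsonLoop (znRep 2) x' i' j' R' T' U) =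
      ∑ U ∈ (rectPlaqs x i j R T).powerset, ∑ U' ∈ (rectPlaqs x' i' j' R' T').powerset,
        ((-Real.sinh (2 * dualBeta β)) ^ U.card * Real.cosh (2 * dualBeta β) ^ (rectPlaqs x i j R T \ U).card) *
        ((-Real.sinh (2 * dualBeta β)) ^ U'.card * Real.cosh (2 * dualBeta β) ^ (rectPlaqs x' i' j' R' T' \ U').card) *
          isingCorr (zdGraph 3) (box 3 M) (dualBeta β) 0 .plus (verts U ∆ verts U') := by
  set S := rectPlaqs x i j R T with hSdef
  set S' := rectPlaqs x' i' j' R' T' with hS'def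
  set b := dualBeta β with hb
  have hprod : (fun U : ZdGaugeConfig 3 ↥(rootsOfUnityCircle 2) =>
      zdWilsonLoop (znRep 2) x i j R T U * zdWilsonLoop (znRep 2) x' i' j' R' T' U) =
      fun U => ∏ p ∈ S ∪ S', plaqSpin U p := by
    funext U
    rw [zdWilsonLoop_znRep_two_eq_prod_plaqSpin x hij.ne R T U,
      zdWilsonLoop_znRep_two_eq_prod_plaqSpin x' hij'.ne R' T' U, prod_plaqSpin_mul_prod_plaqSpin,
      hdisj.symmDiff_eq_sup, Finset.sup_eq_union]
  have himg : Disjoint (S.image dualEdge) (S'.image dualEdge) := by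
    rw [Finset.disjoint_left]
    intro e he he'
    obtain ⟨f, hf, rfl⟩ := Finset.mem_image.1 he
    obtain ⟨g, hg, hfg⟩ := Finset.mem_image.1 he'
    have hgf : g = f :=
      dualEdge_inj_of_oriented (sheetFace_oriented hij' hg) (sheetFace_oriented hij hf) hfg
    exact Finset.disjoint_left.1 hdisj hf (hgf ▸ hg)
  have hdW : disorderWeight b ((S ∪ S').image dualEdge) = fun σ =>
      ∑ p ∈ S.powerset ×ˢ S'.powerset,
        (((-Real.sinh (2 * b)) ^ p.1.card * Real.cosh (2 * b) ^ (S \ p.1).card) *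
          ((-Real.sinh (2 * b)) ^ p.2.card * Real.cosh (2 * b) ^ (S' \ p.2).card)) *
          spinProduct (verts p.1 ∆ verts p.2) σ := by
    funext σ
    rw [Finset.image_union]
    unfold disorderWeight
    rw [Finset.prod_union himg]
    change disorderWeight b (S.image dualEdge) σ * disorderWeight b (S'.image dualEdge) σ = _
    rw [disorderWeight_rectPlaqs_eq_sum b x hij R T σ, disorderWeight_rectPlaqs_eq_sum b x' hij' R' T' σ,
      Finset.sum_mul_sum, Finset.sum_product]
    refine Finset.sum_congr rfl fun U _ => Finset.sum_congr rfl fun U' _ => ?_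
    rw [← spinProduct_mul_spinProduct]
    ring
  rw [hprod, zdExpect_z2_prod_plaqSpin_eq_isingExpect_plus_disorderWeight hβ (Finset.union_subset hS hS'),
    hdW, isingExpect_sum_mul_spinProduct, Finset.sum_product]

/-- **Duality of the truncated two-loop function, finite volume**: for `β > 0` and disjoint flat
sheets `𝒮`, `𝒮'` in the gauge box `ΛG_M`,
`⟨W_γ W_{γ'}⟩ - ⟨W_γ⟩⟨W_{γ'}⟩ (free, ΛG_M, β)
  = ∑_{U ⊆ 𝒮, U' ⊆ 𝒮'} c_U c'_{U'} (⟨σ_{verts U}σ_{verts U'}⟩⁺ - ⟨σ_{verts U}⟩⁺⟨σ_{verts U'}⟩⁺) (box M, β*)`.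
[cite: Aizenman2025, §9.2 Thm 9.2 (2), §9.3; Wegner1971 §III] -/
theorem zdCov_wilsonLoop_eq_sum {β : ℝ} (hβ : 0 < β) {x x' : Probability.LatticeModels.Site 3}
    {i j i' j' : Fin 3} (hij : i < j) (hij' : i' < j') {R T R' T' : ℕ}
    (hS : rectPlaqs x i j R T ⊆ plaquettesIn (gaugeBox M))
    (hS' : rectPlaqs x' i' j' R' T' ⊆ plaquettesIn (gaugeBox M))
    (hdisj : Disjoint (rectPlaqs x i j R T) (rectPlaqs x' i' j' R' T')) :
    zdExpect (znRep 2) β (gaugeBox M) (fun U =>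
        zdWilsonLoop (znRep 2) x i j R T U * zdWilsonLoop (znRep 2) x' i' j' R' T' U) -
      zdExpect (znRep 2) β (gaugeBox M) (zdWilsonLoop (znRep 2) x i j R T) *
        zdExpect (znRep 2) β (gaugeBox M) (zdWilsonLoop (znRep 2) x' i' j' R' T') =
      ∑ U ∈ (rectPlaqs x i j R T).powerset, ∑ U' ∈ (rectPlaqs x' i' j' R' T').powerset,
        ((-Real.sinh (2 * dualBeta β)) ^ U.card * Real.cosh (2 * dualBeta β) ^ (rectPlaqs x i j R T \ U).card) *
        ((-Real.sinh (2 * dualBeta β)) ^ U'.card * Real.cosh (2 * dualBeta β) ^ (rectPlaqs x' i' j' R' T' \ U').card) *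
          (isingCorr (zdGraph 3) (box 3 M) (dualBeta β) 0 .plus (verts U ∆ verts U') -
            isingCorr (zdGraph 3) (box 3 M) (dualBeta β) 0 .plus (verts U) *
              isingCorr (zdGraph 3) (box 3 M) (dualBeta β) 0 .plus (verts U')) := by
  rw [zdExpect_wilsonLoop_mul_eq_sum hβ hij hij' hS hS' hdisj, zdExpect_wilsonLoop_eq_sum hβ hij hS,
    zdExpect_wilsonLoop_eq_sum hβ hij' hS', Finset.sum_mul_sum, ← Finset.sum_sub_distrib]
  refine Finset.sum_congr rfl fun U _ => ?_
  rw [← Finset.sum_sub_distrib]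
  refine Finset.sum_congr rfl fun U' _ => ?_
  ring

end FiniteVolume

/-! ### §4 Duality of the truncated two-loop function, infinite volume -/

section InfiniteVolume

/-- **Duality of truncated Wilson-loop correlations (`ℤ₂` LGT₃ ↔ Ising₃), infinite volume**: for
`β > 0` and disjoint flat sheets,
`⟨W_γ ; W_{γ'}⟩_β = ∑_{U ⊆ 𝒮, U' ⊆ 𝒮'} c_U c'_{U'} (⟨σ_{verts U}σ_{verts U'}⟩⁺_{β*} - ⟨σ_{verts U}⟩⁺_{β*}⟨σ_{verts U'}⟩⁺_{β*})`
— both sides are limits of the two sides of `zdCov_wilsonLoop_eq_sum` (gauge side along the gauge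
boxes by region monotonicity, Ising side along the cubes). [cite: Aizenman2025, §9.2 Thm 9.2 (2), §9.3; DuncanSchweinhart2026 Prop. 24 (p. 19)] -/
theorem znWilsonPairCov_eq_sum_plusCov {β : ℝ} (hβ : 0 < β) {x x' : Probability.LatticeModels.Site 3}
    {i j i' j' : Fin 3} (hij : i < j) (hij' : i' < j') {R T R' T' : ℕ}
    (hdisj : Disjoint (rectPlaqs x i j R T) (rectPlaqs x' i' j' R' T')) :
    znWilsonPairCov 2 β x i j R T x' i' j' R' T' =
      ∑ U ∈ (rectPlaqs x i j R T).powerset, ∑ U' ∈ (rectPlaqs x' i' j' R' T').powerset,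
        ((-Real.sinh (2 * dualBeta β)) ^ U.card * Real.cosh (2 * dualBeta β) ^ (rectPlaqs x i j R T \ U).card) *
        ((-Real.sinh (2 * dualBeta β)) ^ U'.card * Real.cosh (2 * dualBeta β) ^ (rectPlaqs x' i' j' R' T' \ U').card) *
          (plusCorr 3 (dualBeta β) 0 (verts U ∆ verts U') -
            plusCorr 3 (dualBeta β) 0 (verts U) * plusCorr 3 (dualBeta β) 0 (verts U')) := by
  have hβs : 0 ≤ dualBeta β := (dualBeta_pos hβ).le
  -- gauge side along the gauge boxes
  have hP : Tendsto (fun M : ℕ => zdExpect (znRep 2) β (gaugeBox M) (fun U =>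
      zdWilsonLoop (znRep 2) x i j R T U * zdWilsonLoop (znRep 2) x' i' j' R' T' U)) atTop
      (𝓝 (znWilsonPairLimit 2 β x i j R T x' i' j' R' T')) :=
    tendsto_gaugeBox_of_mono
      (fun _ _ hΛ => zdExpect_zn_wilsonLoop_mul_mono_region hβ.le hΛ x x' hij.ne hij'.ne R T R' T')
      (hasBoxLimit_znWilsonPairLimit hβ.le x x' hij.ne hij'.ne R T R' T')
  have hA : Tendsto (fun M : ℕ => zdExpect (znRep 2) β (gaugeBox M) (zdWilsonLoop (znRep 2) x i j R T))
      atTop (𝓝 (znWilsonLoopLimit 2 β x i j R T)) :=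
    tendsto_gaugeBox_of_mono (fun _ _ hΛ => zdExpect_zn_wilsonLoop_mono_region hβ.le hΛ x hij.ne R T)
      (hasBoxLimit_znWilsonLoopLimit hβ.le x hij.ne R T)
  have hB : Tendsto (fun M : ℕ => zdExpect (znRep 2) β (gaugeBox M) (zdWilsonLoop (znRep 2) x' i' j' R' T'))
      atTop (𝓝 (znWilsonLoopLimit 2 β x' i' j' R' T')) :=
    tendsto_gaugeBox_of_mono (fun _ _ hΛ => zdExpect_zn_wilsonLoop_mono_region hβ.le hΛ x' hij'.ne R' T')
      (hasBoxLimit_znWilsonLoopLimit hβ.le x' hij'.ne R' T')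
  have hG : Tendsto (fun M : ℕ => zdExpect (znRep 2) β (gaugeBox M) (fun U =>
      zdWilsonLoop (znRep 2) x i j R T U * zdWilsonLoop (znRep 2) x' i' j' R' T' U) -
      zdExpect (znRep 2) β (gaugeBox M) (zdWilsonLoop (znRep 2) x i j R T) *
        zdExpect (znRep 2) β (gaugeBox M) (zdWilsonLoop (znRep 2) x' i' j' R' T')) atTop
      (𝓝 (znWilsonPairCov 2 β x i j R T x' i' j' R' T')) := hP.sub (hA.mul hB)
  -- Ising side along the cubes
  have hI : Tendsto (fun M : ℕ =>
      ∑ U ∈ (rectPlaqs x i j R T).powerset, ∑ U' ∈ (rectPlaqs x' i' j' R' T').powerset,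
        ((-Real.sinh (2 * dualBeta β)) ^ U.card * Real.cosh (2 * dualBeta β) ^ (rectPlaqs x i j R T \ U).card) *
        ((-Real.sinh (2 * dualBeta β)) ^ U'.card * Real.cosh (2 * dualBeta β) ^ (rectPlaqs x' i' j' R' T' \ U').card) *
          (isingCorr (zdGraph 3) (box 3 M) (dualBeta β) 0 .plus (verts U ∆ verts U') -
            isingCorr (zdGraph 3) (box 3 M) (dualBeta β) 0 .plus (verts U) *
              isingCorr (zdGraph 3) (box 3 M) (dualBeta β) 0 .plus (verts U'))) atTop
      (𝓝 (∑ U ∈ (rectPlaqs x i j R T).powerset, ∑ U' ∈ (rectPlaqs x' i' j' R' T').powerset,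
        ((-Real.sinh (2 * dualBeta β)) ^ U.card * Real.cosh (2 * dualBeta β) ^ (rectPlaqs x i j R T \ U).card) *
        ((-Real.sinh (2 * dualBeta β)) ^ U'.card * Real.cosh (2 * dualBeta β) ^ (rectPlaqs x' i' j' R' T' \ U').card) *
          (plusCorr 3 (dualBeta β) 0 (verts U ∆ verts U') -
            plusCorr 3 (dualBeta β) 0 (verts U) * plusCorr 3 (dualBeta β) 0 (verts U')))) :=
    tendsto_finsetSum _ fun U _ => tendsto_finsetSum _ fun U' _ =>
      ((hasBoxLimit_isingCorr_plus_holds hβs le_rfl _).sub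
        ((hasBoxLimit_isingCorr_plus_holds hβs le_rfl _).mul
          (hasBoxLimit_isingCorr_plus_holds hβs le_rfl _))).const_mul _
  -- the two sequences agree eventually
  obtain ⟨M₁, hM₁⟩ := exists_rectPlaqs_subset_faces x hij R T
  obtain ⟨M₂, hM₂⟩ := exists_rectPlaqs_subset_faces x' hij' R' T'
  refine tendsto_nhds_unique (hG.congr' ?_) hI
  filter_upwards [eventually_ge_atTop (max M₁ M₂)] with M hM
  exact zdCov_wilsonLoop_eq_sum hβ hij hij' (hM₁ M (le_of_max_le_left hM))
    (hM₂ M (le_of_max_le_right hM)) hdisj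

end InfiniteVolume

/-! ### §5 The deconfined phase: exponential clustering of Wilson loops -/

section Deconfined

/-- A double sum of products `a_U b_{U'} F(U,U')` with `|a_U| ≤ α`, `|b_{U'}| ≤ α'`, `0 ≤ F ≤ Φ`
is at most `|P| |P'| α α' Φ`. [folklore] -/
private theorem sum_sum_mul_mul_le {ι κ : Type*} (P : Finset ι) (P' : Finset κ) (a : ι → ℝ)
    (b : κ → ℝ) (F : ι → κ → ℝ) {α α' Φ : ℝ} (ha : ∀ U ∈ P, |a U| ≤ α) (hb : ∀ U' ∈ P', |b U'| ≤ α')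
    (hF0 : ∀ U ∈ P, ∀ U' ∈ P', 0 ≤ F U U') (hF : ∀ U ∈ P, ∀ U' ∈ P', F U U' ≤ Φ) :
    ∑ U ∈ P, ∑ U' ∈ P', a U * b U' * F U U' ≤ P.card * P'.card * (α * α' * Φ) := by
  have hterm : ∀ U ∈ P, ∀ U' ∈ P', a U * b U' * F U U' ≤ α * α' * Φ := by
    intro U hU U' hU'
    have h0 := hF0 U hU U' hU'
    have hα : 0 ≤ α := (abs_nonneg _).trans (ha U hU)
    have hα' : 0 ≤ α' := (abs_nonneg _).trans (hb U' hU')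
    calc a U * b U' * F U U' ≤ |a U * b U'| * F U U' := mul_le_mul_of_nonneg_right (le_abs_self _) h0
      _ = |a U| * |b U'| * F U U' := by rw [abs_mul]
      _ ≤ α * α' * Φ := by
          have h1 : |a U| * |b U'| ≤ α * α' := mul_le_mul (ha U hU) (hb U' hU') (abs_nonneg _) hα
          exact mul_le_mul h1 (hF U hU U' hU') h0 (mul_nonneg hα hα')
  calc _ ≤ ∑ U ∈ P, ∑ U' ∈ P', α * α' * Φ :=
        Finset.sum_le_sum fun U hU => Finset.sum_le_sum fun U' hU' => hterm U hU U' hU'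
    _ = _ := by simp only [Finset.sum_const, nsmul_eq_mul]; ring

/-- The clustering constant of `IsingHighTemperatureEvenClustering` is monotone in the cardinalities. [folklore] -/
private theorem clusterConst_mono {p q p' q' : ℕ} (hp : p ≤ p') (hq : q ≤ q') :
    (2 : ℝ) ^ (p + q) * (((p + q).factorial : ℝ) * (p * q)) ^ 2 ≤
      (2 : ℝ) ^ (p' + q') * (((p' + q').factorial : ℝ) * (p' * q')) ^ 2 := by
  have h1 : (2 : ℝ) ^ (p + q) ≤ 2 ^ (p' + q') := pow_le_pow_right₀ (by norm_num) (by omega)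
  have h2 : ((p + q).factorial : ℝ) * (p * q) ≤ ((p' + q').factorial : ℝ) * (p' * q') := by
    have := Nat.mul_le_mul (Nat.factorial_le (by omega : p + q ≤ p' + q')) (Nat.mul_le_mul hp hq)
    exact_mod_cast this
  have h0 : 0 ≤ ((p + q).factorial : ℝ) * (p * q) := by positivity
  exact mul_le_mul h1 (pow_le_pow_left₀ h0 h2 2) (by positivity) (by positivity)

/-- **The deconfined-phase bound for far-apart loops.** For `β > β_c`, flat sheets `𝒮` at `x`,
`𝒮'` at `x' + a` with `‖a‖ > K = ‖x - x'‖ + (R+T+1) + (R'+T'+1)`, and the rate `κ` of a bound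
`0 ≤ Cov^∅_{β*}(σ_A,σ_B) ≤ 2^{|A|+|B|}((|A|+|B|)!|A||B|)² e^{-2κD}` for even disjoint `A`, `B` at
distance `≥ D` (as delivered by `freeCorr_evenCov_expDecay_of_lt_criticalBeta` at `β* < β_c^{Ising}`):
`⟨W_γ ; W_{γ'+a}⟩_β ≤ 2^{|𝒮|} 2^{|𝒮'|} cosh(2β*)^{|𝒮|} cosh(2β*)^{|𝒮'|} C(2|𝒮|,2|𝒮'|) e^{-2κ(‖a‖-K)}`.
[cite: ForsstromViklund2025currents, Prop. 6.8 (large β); DuncanSchweinhart2026 Prop. 24 (pp. 19–20, dual-subcritical case); GlimmJaffe1987 §17.2 Cor. 17.2.2] -/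
theorem znWilsonPairCov_le_of_gt_critical_of_far {β : ℝ} (h : z2GaugeCriticalBetaThree < β) {κ : ℝ}
    (hclust : ∀ (A B : Finset (Probability.LatticeModels.Site 3)), Even A.card → Even B.card → Disjoint A B →
      ∀ D : ℝ, (∀ a ∈ A, ∀ b ∈ B, D ≤ ‖a - b‖) →
        0 ≤ freeCorr 3 (dualBeta β) 0 (A ∆ B) - freeCorr 3 (dualBeta β) 0 A * freeCorr 3 (dualBeta β) 0 B ∧
        freeCorr 3 (dualBeta β) 0 (A ∆ B) - freeCorr 3 (dualBeta β) 0 A * freeCorr 3 (dualBeta β) 0 B ≤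
          2 ^ (A.card + B.card) * (((A.card + B.card).factorial : ℝ) * (A.card * B.card)) ^ 2 *
            Real.exp (-(2 * κ * D)))
    (x x' : Probability.LatticeModels.Site 3) {i j i' j' : Fin 3} (hij : i < j) (hij' : i' < j')
    (R T R' T' : ℕ) {a : Probability.LatticeModels.Site 3}
    (ha : ‖x - x'‖ + (R + T + 1) + (R' + T' + 1) < ‖a‖) :
    znWilsonPairCov 2 β x i j R T (x' + a) i' j' R' T' ≤
      (2 : ℝ) ^ (rectPlaqs x i j R T).card * (2 : ℝ) ^ (rectPlaqs (x' + a) i' j' R' T').card *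
        (Real.cosh (2 * dualBeta β) ^ (rectPlaqs x i j R T).card *
          Real.cosh (2 * dualBeta β) ^ (rectPlaqs (x' + a) i' j' R' T').card *
          ((2 : ℝ) ^ (2 * (rectPlaqs x i j R T).card + 2 * (rectPlaqs (x' + a) i' j' R' T').card) *
            (((2 * (rectPlaqs x i j R T).card + 2 * (rectPlaqs (x' + a) i' j' R' T').card).factorial : ℝ) *
              ((2 * (rectPlaqs x i j R T).card : ℕ) * (2 * (rectPlaqs (x' + a) i' j' R' T').card : ℕ))) ^ 2 *
            Real.exp (-(2 * κ * (‖a‖ - (‖x - x'‖ + (R + T + 1) + (R' + T' + 1))))))) := by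
  have hβ : 0 < β := z2GaugeCriticalBetaThree_pos.trans h
  have hβs : 0 ≤ dualBeta β := (dualBeta_pos hβ).le
  obtain ⟨hdisj, hvdisj⟩ := disjoint_of_far (i := i) (j := j) (i' := i') (j' := j') (R := R) (T := T)
    (R' := R') (T' := T') ha
  rw [znWilsonPairCov_eq_sum_plusCov hβ hij hij' hdisj]
  simp only [plusCorr_dualBeta_eq_freeCorr h]
  have hc1 : (((rectPlaqs x i j R T).powerset.card : ℕ) : ℝ) = (2 : ℝ) ^ (rectPlaqs x i j R T).card := by
    rw [Finset.card_powerset, Nat.cast_pow, Nat.cast_ofNat]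
  have hc2 : (((rectPlaqs (x' + a) i' j' R' T').powerset.card : ℕ) : ℝ) =
      (2 : ℝ) ^ (rectPlaqs (x' + a) i' j' R' T').card := by
    rw [Finset.card_powerset, Nat.cast_pow, Nat.cast_ofNat]
  rw [← hc1, ← hc2]
  refine sum_sum_mul_mul_le _ _ _ _
    (fun U U' => freeCorr 3 (dualBeta β) 0 (verts U ∆ verts U') -
      freeCorr 3 (dualBeta β) 0 (verts U) * freeCorr 3 (dualBeta β) 0 (verts U'))
    (fun U hU => abs_coef_le hβs (Finset.mem_powerset.1 hU))
    (fun U' hU' => abs_coef_le hβs (Finset.mem_powerset.1 hU')) (fun U hU U' hU' => ?_) (fun U hU U' hU' => ?_)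
  · -- Griffiths II
    have hU := Finset.mem_powerset.1 hU; have hU' := Finset.mem_powerset.1 hU'
    exact (hclust (verts U) (verts U') (even_card_verts_of_subset_rectPlaqs hij.ne hU)
      (even_card_verts_of_subset_rectPlaqs hij'.ne hU') (hvdisj hU hU') _
      (fun v hv v' hv' => norm_sub_ge_of_mem_verts (verts_mono hU hv) (verts_mono hU' hv'))).1
  · have hU := Finset.mem_powerset.1 hU; have hU' := Finset.mem_powerset.1 hU'
    refine (hclust (verts U) (verts U') (even_card_verts_of_subset_rectPlaqs hij.ne hU)
      (even_card_verts_of_subset_rectPlaqs hij'.ne hU') (hvdisj hU hU') _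
      (fun v hv v' hv' => norm_sub_ge_of_mem_verts (verts_mono hU hv) (verts_mono hU' hv'))).2.trans ?_
    refine mul_le_mul_of_nonneg_right ?_ (Real.exp_pos _).le
    have h1 : (verts U).card ≤ 2 * (rectPlaqs x i j R T).card :=
      (card_verts_le U).trans (Nat.mul_le_mul_left 2 (Finset.card_le_card hU))
    have h2 : (verts U').card ≤ 2 * (rectPlaqs (x' + a) i' j' R' T').card :=
      (card_verts_le U').trans (Nat.mul_le_mul_left 2 (Finset.card_le_card hU'))
    have := clusterConst_mono h1 h2
    push_cast at this ⊢
    exact this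

/-- **Exponential clustering of Wilson loops of `ℤ₂` lattice gauge theory on `ℤ³` in the whole
DECONFINED phase, as a THEOREM** (the large-`β` half of Forsström–Viklund 2025, Prop. 6.8 for
`d = 3`, `G = ℤ₂`; the fixed-loop, dual-subcritical case of Duncan–Schweinhart 2026, Prop. 24): for
every `β > β_c = artanh e^{-2β_c^{Ising}(ℤ³)}` there is `m > 0` — explicitly `m = 2κ(β*)`, twice the
sharpness rate of the dual Ising two-point function at `β* = -½ log tanh β < β_c^{Ising}` — such that
for all rectangular loops `γ = ∂(rectPlaqs x i j R T)`, `γ' = ∂(rectPlaqs x' i' j' R' T')` in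
coordinate planes (`i < j`, `i' < j'`) there is `c` with, for every lattice vector `a`,
`0 ≤ ⟨W_γ ; W_{γ'+a}⟩_β ≤ c e^{-m‖a‖}` (`⟨· ; ·⟩_β = znWilsonPairCov 2 β`, the connected two-loop
function of the free infinite-volume state; `‖·‖` the sup norm). Proof: duality of truncated
correlations (§4), plus = free at `β*` (Lebowitz–Martin-Löf), the lattice Glimm–Jaffe §17.2 bound for
the even dual observables `σ_{verts U}` (pair truncation, Newman's Gaussian inequality, sharpness),
and `0 ≤ Cov ≤ 1` for nearby translates. No named fact is used. The strong-coupling half is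
`znWilsonPairCov_strongCoupling_clustering`. [cite: ForsstromViklund2025currents, Prop. 6.8 (β large, d = 3); DuncanSchweinhart2026 Prop. 24 (pp. 19–20); Aizenman2025 §9.2 Thm 9.2 (2); GlimmJaffe1987 §17.2 Thm. 17.2.1, Cor. 17.2.2] -/
theorem znWilsonPairCov_deconfined_clustering {β : ℝ} (h : z2GaugeCriticalBetaThree < β) :
    ∃ m : ℝ, 0 < m ∧ ∀ (x x' : Probability.LatticeModels.Site 3) (i j i' j' : Fin 3), i < j → i' < j' →
      ∀ (R T R' T' : ℕ), ∃ c : ℝ, ∀ a : Probability.LatticeModels.Site 3,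
        0 ≤ znWilsonPairCov 2 β x i j R T (x' + a) i' j' R' T' ∧
        znWilsonPairCov 2 β x i j R T (x' + a) i' j' R' T' ≤ c * Real.exp (-(m * ‖a‖)) := by
  have hβ : 0 < β := z2GaugeCriticalBetaThree_pos.trans h
  have hβs0 : 0 ≤ dualBeta β := (dualBeta_pos hβ).le
  have hβsc : dualBeta β < criticalBeta 3 := dualBeta_lt_criticalBeta h
  obtain ⟨κ, hκ, hclust⟩ :=
    freeCorr_evenCov_expDecay_of_lt_criticalBeta (d := 3) (by norm_num) hβs0 hβsc
  refine ⟨2 * κ, by positivity, fun x x' i j i' j' hij hij' R T R' T' => ?_⟩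
  -- the loops being fixed, `|𝒮| = RT`-type quantities do not depend on the translate `a`
  have hcardS' : ∀ a : Probability.LatticeModels.Site 3,
      (rectPlaqs (x' + a) i' j' R' T').card = (rectPlaqs x' i' j' R' T').card := by
    intro a
    unfold rectPlaqs
    rw [Finset.card_image_of_injective _ (rectPlaqs_map_injective (x' + a) hij'.ne),
      Finset.card_image_of_injective _ (rectPlaqs_map_injective x' hij'.ne)]
  set K : ℝ := ‖x - x'‖ + (R + T + 1) + (R' + T' + 1) with hK
  set n₁ := (rectPlaqs x i j R T).card with hn₁
  set n₂ := (rectPlaqs x' i' j' R' T').card with hn₂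
  set B : ℝ := (2 : ℝ) ^ n₁ * (2 : ℝ) ^ n₂ *
    (Real.cosh (2 * dualBeta β) ^ n₁ * Real.cosh (2 * dualBeta β) ^ n₂ *
      ((2 : ℝ) ^ (2 * n₁ + 2 * n₂) * (((2 * n₁ + 2 * n₂).factorial : ℝ) * ((2 * n₁ : ℕ) * (2 * n₂ : ℕ))) ^ 2)) with hB
  have hB0 : 0 ≤ B := by
    have := (Real.cosh_pos (2 * dualBeta β)).le
    positivity
  refine ⟨(B + 1) * Real.exp (2 * κ * K), fun a => ⟨znWilsonPairCov_nonneg hβ.le _ _ hij.ne hij'.ne _ _ _ _, ?_⟩⟩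
  have hexpK : Real.exp (2 * κ * K) * Real.exp (-(2 * κ * ‖a‖)) = Real.exp (-(2 * κ * (‖a‖ - K))) := by
    rw [← Real.exp_add]; ring_nf
  rcases le_or_gt ‖a‖ K with hle | hfar
  · -- nearby translates: `Cov ≤ 1 ≤ e^{2κ(K - ‖a‖)}`
    have h1 : znWilsonPairCov 2 β x i j R T (x' + a) i' j' R' T' ≤ 1 :=
      znWilsonPairCov_le_one hβ.le _ _ hij.ne hij'.ne _ _ _ _
    have h2 : (1 : ℝ) ≤ Real.exp (-(2 * κ * (‖a‖ - K))) := by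
      rw [← Real.exp_zero]; exact Real.exp_le_exp.2 (by nlinarith)
    have h3 : 0 < Real.exp (-(2 * κ * (‖a‖ - K))) := Real.exp_pos _
    calc _ ≤ (1 : ℝ) := h1
      _ ≤ (B + 1) * Real.exp (-(2 * κ * (‖a‖ - K))) := by nlinarith
      _ = (B + 1) * (Real.exp (2 * κ * K) * Real.exp (-(2 * κ * ‖a‖))) := by rw [hexpK]
      _ = (B + 1) * Real.exp (2 * κ * K) * Real.exp (-(2 * κ * ‖a‖)) := by ring
  · have hmain := znWilsonPairCov_le_of_gt_critical_of_far h hclust x x' hij hij' R T R' T' hfar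
    rw [hcardS' a] at hmain
    have h3 : 0 < Real.exp (-(2 * κ * (‖a‖ - K))) := Real.exp_pos _
    calc _ ≤ B * Real.exp (-(2 * κ * (‖a‖ - K))) := by rw [hB, hK]; linarith [hmain]
      _ ≤ (B + 1) * Real.exp (-(2 * κ * (‖a‖ - K))) := by nlinarith
      _ = (B + 1) * (Real.exp (2 * κ * K) * Real.exp (-(2 * κ * ‖a‖))) := by rw [hexpK]
      _ = (B + 1) * Real.exp (2 * κ * K) * Real.exp (-(2 * κ * ‖a‖)) := by ring

end Deconfined

end Z2Duality

end Literature.MathematicalPhysics.QuantumFieldTheory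

end
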